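import Summits.QuantumFields.YangMills.Theorems.UnitScaleTiltProp7CovCombMeanCentred
import Summits.QuantumFields.YangMills.Theorems.UnitScaleTiltProp7CovIterLambdaBound
import Summits.QuantumFields.YangMills.Theorems.UnitScaleTiltProp7CovariantCoercivity
import HarnessLib

/-!
# Route `UnitScaleTilt`, crux K1 «MinimiserStabilityRegPr» (stmt-QuantumFields-19200), route-R [RP] at a curved background — THE CURVED N6,
# ROW (R-B), PART 4a: FRAMES FOR THE PER-LEVEL COMB TERM — the dictionary between the Thm 3.11 engine's letters (`(M_N)ˣ`, `holT`, `treeWord`, corner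
# combs) and the averaging letters (`SU(N)`, `holAt ∘ walk`, `stairWord`), the frame defect of the CORNER comb frame seen from the centre, the covariant
# centring with a pre-transport, and «block bonds = interior offset pairs»

Cell `ym3-torus`, D-0154 (3c) R3 twin-width seat `ym-routeR-w2` (W-SEAT MAP pass #3 row M9: «(R-B) instantiation»; architecture «ℓ²-Minkowski over levels,
level-local», ★★OWNER g26 ACK 12).  Companion of ✓ `UnitScaleTiltProp7CovCombMeanCentred`, ✓ `UnitScaleTiltProp7CovBlockPoincareCentred`,
✓ `UnitScaleTiltProp7CovIterLambdaBound`; consumed by `UnitScaleTiltProp7CovCombMeanPoincare` (the per-level `ℓ²` bound).  THEOREMS ONLY (0 `def`, 0 `sorry`);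
`--supports stmt-QuantumFields-19200`, count-neutral.  YM₃ on T³ is a ladder rung (R3), not the Clay problem; nothing here claims the curved N6 bound, S2, P, the
crux or the gap.

WHY.  The recursion of record (✓ p606268 `Prop7TrueLinIterStructure`, `hΛs : Λ_{k+1}(z) = CM_k(G_k)(z) + Λ_k(emb z)`) has the per-level term
`CM_j(X)(z) = |I|⁻¹Σ_i X_V(Γ^{σ_i}_{z→x_i})` in the `SU(N)`∕`holAt`∕`stairWord` letters of `BlockAveragingEMLLinearisedBackground`, while the block Poincaré
inequality `Prop7CovariantCoercivity.block_poincare_comb` (and its mean-subtracted form `Prop7CovBlockPoincareCentred`) is written in the `(M_N)ˣ`∕`holT`∕`treeWord`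
letters with comb frames from the block CORNER `ȳ`.  This file bridges the two.
* §1 `coe_holT_su`, `coe_inv_holT_su`, `conjR_holT_su`, `conjR_bond_su` (`holT (unitsField (toUField V)) = holAt V ∘ walk`, inverse = `star`); `intOffset_bsite`.
* §2 `disp_apply_eq_netDisp`, `walkEnd_treeWord`; ★ `frame_defect_corner_le` — with the pre-transport `W = V(Γ_{ȳ→emb z})` the transports
  `ȳ → emb z → y → ȳ` close up into a lattice loop of length `≤ 2d(L−1)`, within `(dL)²·a` of `1` (`LatticeWordStokes.dist1_holAt_le`).
* §3 ★ `norm_covCombMean_le_osc_frame` — `Prop7CovCombMeanCentred.norm_covCombMean_le_osc` with a pre-transport `W` in the frame condition (isometry + `Σ_r off r = 0`).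
* §4 `exists_offset_of_blockOf` — a bond with both end-points in `B(z)` is an interior offset pair (site counts per direction are `≥ 2`: no wrap inside a block).
HONEST SCOPE.  Bookkeeping over tree letters and the tree's non-abelian Stokes bound; nothing of Bałaban's analysis is asserted beyond them.

References: T. Bałaban, CMP 98 (1985) 17–51 [Balaban1985Averaging] ((19)–(20) p.21, (56) p.27, (62) p.28); CMP 109 (1987) 249–301 [Balaban1987RG1] ((0.3) p.252).
-/

noncomputable section

open scoped BigOperators Matrix.Norms.L2Operator

namespace Summit.QuantumFields.YangMills.Theorems.Prop7CovCombMeanFrames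

open Literature.MathematicalPhysics.QuantumFieldTheory.Balaban1983to89
open Finset T4Continuum BlockAveraging AveragingRT BlockAveragingEMLLinearised BlockAveragingEMLLinearisedBackground B1RG242Torus
open B7Prop1Explicit (treeWord plaqWord l1 U1 disp disp_cons disp_treeWord length_treeWord)
open B7Eq78Linearization (conjR conjR_apply)
open B10Eq27TorusAxialLog (holT unitsField toUField val_holT_unitsField holT_toUField val_suIncl holT_eq_holAt)
open Beta.CoordCubePoincare (stepUp)
open B5Leaf237C0Torus (bsite bsite_stepUp sum_bsite)
open Summit.QuantumFields.YangMills.Theorems.Prop7CovCombMeanCentred (norm_conj_covWalkSum_sub_netDisp_le)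
open Summit.QuantumFields.YangMills.Theorems.Prop7CombMeanCentred (sum_off_eq_zero)
open Summit.QuantumFields.YangMills.Theorems.ChartHInv (blockOf_of_mem_walk_stairWord)
open Summit.QuantumFields.YangMills.Theorems.Prop8Chart (norm_card_inv_smul_sum_le)

variable {N : ℕ} [NeZero N] {P : Params} {j : ℕ}

/-! ## §1 The dictionary between the engine's letters and the averaging letters -/

/-- The comb∕line transports of the engine, read on an `SU(N)` background, are the `SU(N)` holonomies of the corresponding walks (as matrices). [folklore] -/
theorem coe_holT_su (V : GaugeField P j (Matrix.specialUnitaryGroup (Fin N) ℂ)) (x : Site P j) (w : List (Letter P.d)) :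
    ((holT (unitsField (toUField V)) x w : (Matrix (Fin N) (Fin N) ℂ)ˣ) : Matrix (Fin N) (Fin N) ℂ)
      = ((holAt V (walk x w) : Matrix.specialUnitaryGroup (Fin N) ℂ) : Matrix (Fin N) (Fin N) ℂ) := by
  rw [val_holT_unitsField, holT_toUField, val_suIncl, holT_eq_holAt]

/-- … and their inverses are the conjugate transposes. [folklore] -/
theorem coe_inv_holT_su (V : GaugeField P j (Matrix.specialUnitaryGroup (Fin N) ℂ)) (x : Site P j) (w : List (Letter P.d)) :
    (((holT (unitsField (toUField V)) x w)⁻¹ : (Matrix (Fin N) (Fin N) ℂ)ˣ) : Matrix (Fin N) (Fin N) ℂ)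
      = star ((holAt V (walk x w) : Matrix.specialUnitaryGroup (Fin N) ℂ) : Matrix (Fin N) (Fin N) ℂ) := by
  set u : (Matrix (Fin N) (Fin N) ℂ)ˣ := holT (unitsField (toUField V)) x w with hu
  set g : Matrix.specialUnitaryGroup (Fin N) ℂ := holAt V (walk x w) with hg
  have h1 : (u : Matrix (Fin N) (Fin N) ℂ) = (g : Matrix (Fin N) (Fin N) ℂ) := coe_holT_su V x w
  have h2 : star (g : Matrix (Fin N) (Fin N) ℂ) * (g : Matrix (Fin N) (Fin N) ℂ) = 1 :=
    Unitary.star_mul_self_of_mem (Matrix.mem_specialUnitaryGroup_iff.1 g.2).1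
  calc ((u⁻¹ : (Matrix (Fin N) (Fin N) ℂ)ˣ) : Matrix (Fin N) (Fin N) ℂ)
      = (star (g : Matrix (Fin N) (Fin N) ℂ) * (g : Matrix (Fin N) (Fin N) ℂ)) * ((u⁻¹ : (Matrix (Fin N) (Fin N) ℂ)ˣ) : Matrix (Fin N) (Fin N) ℂ) := by
        rw [h2, one_mul]
    _ = star (g : Matrix (Fin N) (Fin N) ℂ) * ((u : Matrix (Fin N) (Fin N) ℂ) * ((u⁻¹ : (Matrix (Fin N) (Fin N) ℂ)ˣ) : Matrix (Fin N) (Fin N) ℂ)) := by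
        rw [h1, mul_assoc]
    _ = star (g : Matrix (Fin N) (Fin N) ℂ) := by rw [Units.mul_inv, mul_one]

/-- The engine's comb-frame reading `R(V(Γ))X` in `SU(N)` letters: `V(Γ)·X·V(Γ)*`. [cite: Balaban1985Averaging, (56) p.27] -/
theorem conjR_holT_su (V : GaugeField P j (Matrix.specialUnitaryGroup (Fin N) ℂ)) (x : Site P j) (w : List (Letter P.d)) (X : Matrix (Fin N) (Fin N) ℂ) :
    conjR (holT (unitsField (toUField V)) x w) X
      = ((holAt V (walk x w) : Matrix.specialUnitaryGroup (Fin N) ℂ) : Matrix (Fin N) (Fin N) ℂ) * X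
          * star ((holAt V (walk x w) : Matrix.specialUnitaryGroup (Fin N) ℂ) : Matrix (Fin N) (Fin N) ℂ) := by
  rw [conjR_apply, coe_holT_su, coe_inv_holT_su]

omit [NeZero N] in
/-- The engine's bond transport `R(V_b)X` in `SU(N)` letters. [cite: Balaban1985Averaging, (56) p.27] -/
theorem conjR_bond_su (V : GaugeField P j (Matrix.specialUnitaryGroup (Fin N) ℂ)) (b : PBond P j) (X : Matrix (Fin N) (Fin N) ℂ) :
    conjR (unitsField (toUField V) b) X
      = ((V b : Matrix.specialUnitaryGroup (Fin N) ℂ) : Matrix (Fin N) (Fin N) ℂ) * X * star ((V b : Matrix.specialUnitaryGroup (Fin N) ℂ) : Matrix (Fin N) (Fin N) ℂ) := by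
  rw [conjR_apply]; rfl

/-- The level spacing of the site counts, `|T^{(j)}| = L·|T^{(j+1)}|` per direction (standing range). [folklore] -/
theorem sitesPerDir_eq (hj : j + 1 ≤ P.m + P.K) : P.sitesPerDir j = P.L ^ 1 * P.sitesPerDir (j + 1) := by
  rw [pow_one, mul_comm]; exact P.sitesPerDir_eq_mul_succ hj

/-- `(L − 1) + 1 = L^1`. [folklore] -/
theorem predL_succ : P.L - 1 + 1 = P.L ^ 1 := by rw [pow_one]; exact Nat.sub_add_cancel P.L_pos

/-- The integer offset of the block site `x_r` from the block corner `ȳ = x_0` is `r` (no wrap-around). [folklore] -/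
theorem intOffset_bsite (hj : j + 1 ≤ P.m + P.K) (z : Site P (j + 1)) (r : Fin P.d → Fin (P.L - 1 + 1)) :
    (fun ν => (((bsite P j 1 predL_succ z r) ν).val : ℤ) - (((bsite P j 1 predL_succ z fun _ => 0) ν).val : ℤ)) = fun ν => ((r ν : ℕ) : ℤ) := by
  funext ν
  simp only [bsite, Site.val_fibreSite (sitesPerDir_eq hj), Fin.val_cast, Fin.val_zero]
  push_cast
  ring

/-! ## §2 The frame defect of the corner comb frame seen from the centre -/

/-- The two «net displacement» letters of the tree agree: `disp w ν = netDisp w ν`. [folklore] -/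
theorem disp_apply_eq_netDisp {d : ℕ} : ∀ (w : List (Letter d)) (ν : Fin d), disp w ν = netDisp w ν
  | [], ν => by simp [netDisp]
  | (μ, b) :: w, ν => by
    rw [disp_cons, Pi.add_apply, netDisp_cons, disp_apply_eq_netDisp w ν]
    cases b
    · simp only [B7Prop1Explicit.Letter.vec_false, Pi.neg_apply, B7Prop1Explicit.e_apply, Bool.false_eq_true, ↓reduceIte]
      by_cases h : ν = μ
      · subst h; simp
      · simp [h, Ne.symm h]
    · simp only [B7Prop1Explicit.Letter.vec_true, B7Prop1Explicit.e_apply, ↓reduceIte]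
      by_cases h : ν = μ
      · subst h; simp
      · simp [h, Ne.symm h]

/-- `walkEnd x (treeWord v) = x + v`: the comb word to the integer offset `v` ends there. [folklore] -/
theorem walkEnd_treeWord (x : Site P j) (v : Fin P.d → ℤ) : walkEnd x (treeWord v) = fun ν => x ν + ((v ν : ℤ) : ZMod (P.sitesPerDir j)) := by
  funext ν
  rw [walkEnd_apply, ← disp_apply_eq_netDisp, disp_treeWord]

/-- Passing a strict small-field bound to the non-strict level. [folklore] -/
private theorem le_mul_of_forall_gt {x κ a : ℝ} (hκ : 0 ≤ κ) (h : ∀ δ, a < δ → x ≤ κ * δ) : x ≤ κ * a := by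
  by_contra hx
  push Not at hx
  rcases eq_or_lt_of_le hκ with hκ0 | hκ0
  · have h1 := h (a + 1) (by linarith)
    rw [← hκ0] at h1 hx
    simp at h1 hx
    exact absurd h1 (not_le.mpr hx)
  · have h1 := h (a + (x - κ * a) / (2 * κ)) (by
      have : 0 < (x - κ * a) / (2 * κ) := div_pos (by linarith) (by linarith)
      linarith)
    have e : κ * (a + (x - κ * a) / (2 * κ)) = κ * a + (x - κ * a) / 2 := by field_simp
    rw [e] at h1
    linarith

/-- **THE FRAME DEFECT OF THE CORNER COMB FRAME, SEEN FROM THE CENTRE**: with the pre-transport `W = V(Γ_{ȳ→emb z})` (comb from the corner to the centre), the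
transport along any prefix of any staircase from the centre followed by the inverse corner-comb transport of its end closes up into a lattice loop
`ȳ → emb z → y → ȳ` of length `≤ 2d(L−1)`; at a background with plaquette variables within `a` of `1` its holonomy is within `(dL)²·a` of `1`
(`LatticeWordStokes.dist1_holAt_le`). [cite: Balaban1985Averaging, (19)-(20) p.21; Balaban1987RG1, (0.3) p.252] -/
theorem frame_defect_corner_le (hj : j + 1 ≤ P.m + P.K) (V : GaugeField P j (Matrix.specialUnitaryGroup (Fin N) ℂ)) {a : ℝ} (ha : 0 ≤ a)
    (hV : ∀ q : Plaq P j, dist1 (GaugeField.plaqHol V q) ≤ a) (z : Site P (j + 1)) (σ : Equiv.Perm (Fin P.d)) (r : Fin P.d → Fin P.L) (p : ℕ) :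
    ‖((holAt V (walk (bsite P j 1 predL_succ z fun _ => 0) (treeWord fun ν => (((emb z) ν).val : ℤ) - (((bsite P j 1 predL_succ z fun _ => 0) ν).val : ℤ)))
          * holAt V (walk (emb z) ((stairWord σ (off r)).take p)) : Matrix.specialUnitaryGroup (Fin N) ℂ) : Matrix (Fin N) (Fin N) ℂ) *
        star (((fun y : Site P j => holAt V (walk (bsite P j 1 predL_succ z fun _ => 0)
          (treeWord fun ν => ((y ν).val : ℤ) - (((bsite P j 1 predL_succ z fun _ => 0) ν).val : ℤ))))
          (walkEnd (emb z) ((stairWord σ (off r)).take p)) : Matrix.specialUnitaryGroup (Fin N) ℂ) : Matrix (Fin N) (Fin N) ℂ) - 1‖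
      ≤ (((P.d * P.L : ℕ) : ℝ)) ^ 2 * a := by
  set ybar : Site P j := bsite P j 1 predL_succ z fun _ => 0 with hybar
  set w₁ : List (Letter P.d) := (stairWord σ (off r)).take p with hw₁
  set y : Site P j := walkEnd (emb z) w₁ with hy
  set vc : Fin P.d → ℤ := fun ν => (((emb z) ν).val : ℤ) - ((ybar ν).val : ℤ) with hvc
  set vy : Fin P.d → ℤ := fun ν => ((y ν).val : ℤ) - ((ybar ν).val : ℤ) with hvy
  simp only []
  -- the labels: centre `z_νL + (L−1)/2`, corner `z_νL`, end `z_νL + (L−1)/2 + netDisp w₁`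
  have hh := AveragingRT.two_mul_half_add_one P
  have hybv : ∀ ν, (ybar ν).val = (z ν).val * P.L := fun ν => by
    rw [hybar]; simp only [bsite, Site.val_fibreSite (sitesPerDir_eq hj), Fin.val_cast, Fin.val_zero, pow_one, add_zero]
  have hembv : ∀ ν, ((emb z) ν).val = (z ν).val * P.L + (P.L - 1) / 2 := fun ν => Site.val_emb hj z ν
  have hvc' : ∀ ν, vc ν = (((P.L - 1) / 2 : ℕ) : ℤ) := fun ν => by rw [hvc]; simp only [hembv, hybv]; push_cast; ring
  have hvy' : ∀ ν, vy ν = (((P.L - 1) / 2 : ℕ) : ℤ) + netDisp w₁ ν := fun ν => by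
    have h1 := Prop7CovCombMeanCentred.intOffset_walkEnd_take_stairWord hj z σ r p ν
    rw [hvy]; simp only []; rw [← hw₁, ← hy] at h1; rw [hybv]; rw [hembv] at h1; push_cast at h1 ⊢; linarith
  -- the three walks close up
  have hend_c : walkEnd ybar (treeWord vc) = emb z := by
    rw [walkEnd_treeWord]; funext ν
    rw [← ZMod.natCast_zmod_val ((emb z) ν), ← ZMod.natCast_zmod_val (ybar ν), hvc]
    push_cast; ring
  have hend_y : walkEnd ybar (treeWord vy) = y := by
    rw [walkEnd_treeWord]; funext ν
    rw [← ZMod.natCast_zmod_val (y ν), ← ZMod.natCast_zmod_val (ybar ν), hvy]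
    push_cast; ring
  have hloop : ((holAt V (walk ybar (treeWord vc)) * holAt V (walk (emb z) w₁) : Matrix.specialUnitaryGroup (Fin N) ℂ) : Matrix (Fin N) (Fin N) ℂ) *
        star ((holAt V (walk ybar (treeWord vy)) : Matrix.specialUnitaryGroup (Fin N) ℂ) : Matrix (Fin N) (Fin N) ℂ)
      = ((holAt V (walk ybar (treeWord vc ++ (w₁ ++ wordRev (treeWord vy)))) : Matrix.specialUnitaryGroup (Fin N) ℂ) : Matrix (Fin N) (Fin N) ℂ) := by
    have hinv : ((holAt V (walk ybar (treeWord vy)))⁻¹ : Matrix.specialUnitaryGroup (Fin N) ℂ) = holAt V (walk y (wordRev (treeWord vy))) := by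
      rw [← hend_y, holAt_walk_wordRev]
    have hcoe : star ((holAt V (walk ybar (treeWord vy)) : Matrix.specialUnitaryGroup (Fin N) ℂ) : Matrix (Fin N) (Fin N) ℂ)
        = (((holAt V (walk ybar (treeWord vy)))⁻¹ : Matrix.specialUnitaryGroup (Fin N) ℂ) : Matrix (Fin N) (Fin N) ℂ) := rfl
    rw [hcoe, hinv, ← Submonoid.coe_mul, walk_append, holAt_append, hend_c, walk_append, holAt_append, ← hy, mul_assoc]
  rw [hloop, ← FederbushMean.dist1_SU_eq]
  -- closed and short
  have hclosed : ∀ ν, netDisp (treeWord vc ++ (w₁ ++ wordRev (treeWord vy))) ν = 0 := fun ν => by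
    rw [T4ReflectionCone.netDisp_append, T4ReflectionCone.netDisp_append, netDisp_wordRev, ← disp_apply_eq_netDisp (treeWord vc),
      ← disp_apply_eq_netDisp (treeWord vy), disp_treeWord, disp_treeWord, hvc', hvy']
    ring
  have hN1 : ∀ ν, (off r ν).natAbs ≤ (P.L - 1) / 2 := fun ν => by have h := off_bounds r ν; omega
  have hlen1 : w₁.length ≤ P.d * ((P.L - 1) / 2) := by
    rw [hw₁, List.length_take]
    exact (min_le_right _ _).trans (LatticeWordStokes.length_stairWord_le σ (off r) _ hN1)
  have hlenc : (treeWord vc).length ≤ P.d * ((P.L - 1) / 2) := by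
    rw [length_treeWord, l1]
    calc ∑ κ, (vc κ).natAbs ≤ ∑ _κ : Fin P.d, (P.L - 1) / 2 := Finset.sum_le_sum fun κ _ => by rw [hvc' κ, Int.natAbs_natCast]
      _ = P.d * ((P.L - 1) / 2) := by simp
  have hleny : (wordRev (treeWord vy)).length ≤ P.d * (P.L - 1) := by
    have h0 : (wordRev (treeWord vy)).length = (treeWord vy).length := by simp [wordRev]
    rw [h0, length_treeWord, l1]
    calc ∑ κ, (vy κ).natAbs ≤ ∑ _κ : Fin P.d, (P.L - 1) := Finset.sum_le_sum fun κ _ => by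
            have hb := netDisp_take_stairWord σ (off r) κ p
            have hn := off_bounds r κ
            rw [hvy' κ, ← hw₁] at *
            rcases le_total 0 (off r κ) with h0 | h0
            · rw [min_eq_left h0, max_eq_right h0] at hb; omega
            · rw [min_eq_right h0, max_eq_left h0] at hb; omega
      _ = P.d * (P.L - 1) := by simp
  have hlen : ((treeWord vc ++ (w₁ ++ wordRev (treeWord vy))).length : ℝ) ≤ 2 * ((P.d * P.L : ℕ) : ℝ) := by
    have h3 : (treeWord vc ++ (w₁ ++ wordRev (treeWord vy))).length ≤ 2 * (P.d * P.L) := by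
      rw [List.length_append, List.length_append]
      have : P.d * ((P.L - 1) / 2) + (P.d * ((P.L - 1) / 2) + P.d * (P.L - 1)) ≤ 2 * (P.d * P.L) := by
        rw [← mul_add, ← mul_add, mul_left_comm]; exact Nat.mul_le_mul_left _ (by omega)
      exact le_trans (add_le_add hlenc (add_le_add hlen1 hleny)) this
    exact_mod_cast h3
  refine le_mul_of_forall_gt (by positivity) fun δ hδ => ?_
  have hδ0 : 0 ≤ δ := ha.trans hδ.le
  have h := LatticeWordStokes.dist1_holAt_le V hδ0 (fun q => (hV q).trans_lt hδ) _ hclosed ybar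
  refine h.trans (mul_le_mul_of_nonneg_right ?_ hδ0)
  have h0 : (0 : ℝ) ≤ ((treeWord vc ++ (w₁ ++ wordRev (treeWord vy))).length : ℝ) := Nat.cast_nonneg _
  have := mul_le_mul hlen hlen h0 (by positivity)
  nlinarith

/-! ## §3 The covariant centring with a pre-transport -/

/-- **THE COVARIANT COMB MEAN, CENTRED, WITH A PRE-TRANSPORT `W`** (the `W`-form of `Prop7CovCombMeanCentred.norm_covCombMean_le_osc`): the frame condition is
asked of `W·V(prefix)·τ(end)*` (so that frames based elsewhere than the centre — e.g. the corner comb — are admissible), the conclusion is unchanged since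
conjugation by `W` is an isometry and the frame-read constants still average to zero. [cite: Balaban1985Averaging, (62) p.28; Balaban1987RG1, (0.3)-(0.4) pp.252-253] -/
theorem norm_covCombMean_le_osc_frame (hj : j + 1 ≤ P.m + P.K) (V : GaugeField P j (Matrix.specialUnitaryGroup (Fin N) ℂ))
    (X : PBond P j → Matrix (Fin N) (Fin N) ℂ) (m : Fin P.d → Matrix (Fin N) (Fin N) ℂ) (z : Site P (j + 1))
    (τ : Site P j → Matrix.specialUnitaryGroup (Fin N) ℂ) (W : Matrix.specialUnitaryGroup (Fin N) ℂ) {o θ B : ℝ} (ho : 0 ≤ o) (hθ : 0 ≤ θ) (hB : 0 ≤ B)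
    (hBz : ∀ b : PBond P j, blockOf b.src = z → blockOf b.tgt = z → ‖X b‖ ≤ B)
    (hosc : ∀ b : PBond P j, blockOf b.src = z → blockOf b.tgt = z →
      ‖((τ b.src : Matrix.specialUnitaryGroup (Fin N) ℂ) : Matrix (Fin N) (Fin N) ℂ) * X b *
          star ((τ b.src : Matrix.specialUnitaryGroup (Fin N) ℂ) : Matrix (Fin N) (Fin N) ℂ) - m b.dir‖ ≤ o)
    (hframe : ∀ (σ : Equiv.Perm (Fin P.d)) (r : Fin P.d → Fin P.L) (p : ℕ), p ≤ (stairWord σ (off r)).length →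
      ‖((W * holAt V (walk (emb z) ((stairWord σ (off r)).take p)) : Matrix.specialUnitaryGroup (Fin N) ℂ) : Matrix (Fin N) (Fin N) ℂ) *
          star ((τ (walkEnd (emb z) ((stairWord σ (off r)).take p)) : Matrix.specialUnitaryGroup (Fin N) ℂ) : Matrix (Fin N) (Fin N) ℂ) - 1‖ ≤ θ) :
    ‖((Fintype.card (Idx P) : ℂ))⁻¹ • ∑ i : Idx P, covWalkSum V X (walk (emb z) (stairWord i.2.1 (off i.1)))‖
      ≤ ((P.d + 2) * P.L : ℕ) * (o + 2 * θ * B) := by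
  set CM : Matrix (Fin N) (Fin N) ℂ := ((Fintype.card (Idx P) : ℂ))⁻¹ • ∑ i : Idx P, covWalkSum V X (walk (emb z) (stairWord i.2.1 (off i.1))) with hCM
  -- conjugation by `W` is an isometry
  have hWW : star (W : Matrix (Fin N) (Fin N) ℂ) * (W : Matrix (Fin N) (Fin N) ℂ) = 1 :=
    Unitary.star_mul_self_of_mem (Matrix.mem_specialUnitaryGroup_iff.1 W.2).1
  have hiso : ‖CM‖ ≤ ‖(W : Matrix (Fin N) (Fin N) ℂ) * CM * star (W : Matrix (Fin N) (Fin N) ℂ)‖ := by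
    have h := Prop7CovIterLambdaBound.norm_conj_su_le W⁻¹ ((W : Matrix (Fin N) (Fin N) ℂ) * CM * star (W : Matrix (Fin N) (Fin N) ℂ))
    have hcoe : (((W⁻¹ : Matrix.specialUnitaryGroup (Fin N) ℂ)) : Matrix (Fin N) (Fin N) ℂ) = star (W : Matrix (Fin N) (Fin N) ℂ) := rfl
    rw [hcoe, star_star] at h
    have hid : star (W : Matrix (Fin N) (Fin N) ℂ) * ((W : Matrix (Fin N) (Fin N) ℂ) * CM * star (W : Matrix (Fin N) (Fin N) ℂ)) * (W : Matrix (Fin N) (Fin N) ℂ) = CM := by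
      calc _ = (star (W : Matrix (Fin N) (Fin N) ℂ) * (W : Matrix (Fin N) (Fin N) ℂ)) * CM * (star (W : Matrix (Fin N) (Fin N) ℂ) * (W : Matrix (Fin N) (Fin N) ℂ)) := by
            noncomm_ring
        _ = CM := by rw [hWW, one_mul, mul_one]
    rwa [hid] at h
  refine hiso.trans ?_
  -- the frame-read constants of the staircases average to zero
  set D : Idx P → Matrix (Fin N) (Fin N) ℂ := fun i => ∑ κ : Fin P.d, (off i.1 κ) • m κ with hD
  have hD0 : ∑ i : Idx P, D i = 0 := by
    rw [hD, sum_idx_of_fst (fun r => ∑ κ : Fin P.d, (off r κ) • m κ), Finset.sum_comm]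
    have h0 : ∀ κ : Fin P.d, ∑ r : Fin P.d → Fin P.L, (off r κ) • m κ = 0 := fun κ => by
      rw [← Finset.sum_smul, sum_off_eq_zero, zero_smul]
    simp only [h0, Finset.sum_const_zero, smul_zero]
  have hrw : (W : Matrix (Fin N) (Fin N) ℂ) * CM * star (W : Matrix (Fin N) (Fin N) ℂ)
      = ((Fintype.card (Idx P) : ℂ))⁻¹ • ∑ i : Idx P,
          ((W : Matrix (Fin N) (Fin N) ℂ) * covWalkSum V X (walk (emb z) (stairWord i.2.1 (off i.1))) * star (W : Matrix (Fin N) (Fin N) ℂ) - D i) := by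
    rw [Finset.sum_sub_distrib, hD0, sub_zero, hCM, Matrix.mul_smul, Matrix.smul_mul, Finset.mul_sum, Finset.sum_mul]
  rw [hrw]
  have ht : 0 ≤ (((P.d + 2) * P.L : ℕ) : ℝ) * (o + 2 * θ * B) := by positivity
  refine norm_card_inv_smul_sum_le ht fun i => ?_
  have h := norm_conj_covWalkSum_sub_netDisp_le V X m τ hθ (stairWord i.2.1 (off i.1)) (emb z) W
    (fun s hs => by have hb := blockOf_of_mem_walk_stairWord hj z i.2.1 i.1 hs; exact hBz s.bond hb.1 hb.2)
    (fun s hs => by have hb := blockOf_of_mem_walk_stairWord hj z i.2.1 i.1 hs; exact hosc s.bond hb.1 hb.2)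
    (fun p hp => hframe i.2.1 i.1 p hp)
  simp only [netDisp_stairWord] at h
  refine h.trans (mul_le_mul_of_nonneg_right ?_ (by positivity))
  have hlen := length_walk_stairWord_le (emb z) i.2.1 i.1
  rw [length_walk] at hlen
  exact_mod_cast hlen

/-! ## §4 Bonds with both end-points in a block are interior offset pairs -/

/-- **A BOND WITH BOTH END-POINTS IN `B(z)` IS AN INTERIOR OFFSET PAIR**: its source is the block site of some offset `r` with `r_{dir} < L − 1` (the site counts
per direction are `≥ 2`, so no bond wraps around inside a block). [cite: Balaban1987RG1, (0.3) p.252] -/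
theorem exists_offset_of_blockOf (hj : j + 1 ≤ P.m + P.K) (z : Site P (j + 1)) (b : PBond P j) (hs : blockOf b.src = z) (ht : blockOf b.tgt = z) :
    ∃ r : Fin P.d → Fin (P.L - 1 + 1), bsite P j 1 predL_succ z r = b.src ∧ r b.dir ≠ Fin.last (P.L - 1) := by
  set r' : Fin P.d → Fin P.L := Site.blockEquiv hj z ⟨b.src, hs⟩ with hr'
  have hr'v : ∀ ν, ((r' ν : ℕ)) = (b.src ν).val % P.L := fun ν => rfl
  have hL := P.L_pos
  have hLe : P.L = P.L - 1 + 1 := (Nat.sub_add_cancel hL).symm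
  refine ⟨fun ν => Fin.cast hLe (r' ν), ?_, ?_⟩
  · funext ν
    apply ZMod.val_injective
    simp only [bsite, Site.val_fibreSite (sitesPerDir_eq hj), Fin.val_cast, pow_one]
    have h1 : (b.src ν).val / P.L = (z ν).val := by rw [← Site.val_blockOf hj b.src ν, hs]
    have h2 := Nat.div_add_mod ((b.src ν).val) P.L
    rw [h1] at h2
    rw [hr'v]
    linarith [h2, mul_comm ((z ν).val) P.L]
  · intro hlast
    have hval : ((r' b.dir : ℕ)) = P.L - 1 := by
      have := congrArg Fin.val hlast
      simpa [Fin.val_cast, Fin.val_last] using this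
    -- the target's label in direction `dir` is `(z_dir + 1)·L`
    have hsrc : (b.src b.dir).val = (z b.dir).val * P.L + (P.L - 1) := by
      have h1 : (b.src b.dir).val / P.L = (z b.dir).val := by rw [← Site.val_blockOf hj b.src b.dir, hs]
      have h2 := Nat.div_add_mod ((b.src b.dir).val) P.L
      rw [h1, ← hr'v, hval] at h2
      linarith [mul_comm ((z b.dir).val) P.L]
    have htgt : (b.tgt b.dir) = b.src b.dir + 1 := by
      show (b.src.shift b.dir) b.dir = b.src b.dir + 1
      simp [Site.shift]
    have hq : (b.tgt b.dir).val / P.L = (z b.dir).val := by rw [← Site.val_blockOf hj b.tgt b.dir, ht]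
    rw [htgt, ZMod.val_add, ZMod.val_one, hsrc, P.sitesPerDir_eq_mul_succ hj] at hq
    have hS2 : 2 ≤ P.sitesPerDir (j + 1) := by
      have : 1 ≤ P.L ^ (P.m + P.K - (j + 1)) := Nat.one_le_pow _ _ hL
      show 2 ≤ 2 * P.L ^ (P.m + P.K - (j + 1)); omega
    have hz : (z b.dir).val < P.sitesPerDir (j + 1) := ZMod.val_lt _
    have hsum : (z b.dir).val * P.L + (P.L - 1) + 1 = ((z b.dir).val + 1) * P.L := by
      rw [Nat.add_mul, one_mul]; omega
    rw [hsum] at hq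
    rcases Nat.lt_or_ge ((z b.dir).val + 1) (P.sitesPerDir (j + 1)) with hlt | hge
    · -- no wrap: quotient `z_dir + 1 ≠ z_dir`
      rw [Nat.mod_eq_of_lt (Nat.mul_lt_mul_of_pos_right hlt hL), Nat.mul_div_cancel _ hL] at hq
      omega
    · -- wrap: `(z_dir + 1)L = |T^{(j)}|`, quotient `0 = z_dir = |T^{(j+1)}| − 1 ≥ 1`
      have heq : (z b.dir).val + 1 = P.sitesPerDir (j + 1) := by omega
      rw [heq, Nat.mod_self, Nat.zero_div] at hq
      omega


end Summit.QuantumFields.YangMills.Theorems.Prop7CovCombMeanFrames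

end
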